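import Summits.FinalStateConjecture.FinalStateConjecture.Theorems.ClusterCompletenessAdiabaticMultiKerrILEDZoneDisjoint
import Literature.Geometry.Lorentzian.KerrSchildEnergyEstimate
import HarnessLib

/-!
# Route ClusterCompleteness — crux `AdiabaticMultiKerrILED`, line `Sketch`: collars, shells and the
# far set on a lab slice (helpers for `stub_lateAssembly`)

Helper file for the crux `stmt-FinalStateConjecture-14310`
(`Summit.FinalStateConjecture.FinalStateConjecture.Theses.ClusterCompleteness.AdiabaticMultiKerrILED`),
line `Sketch`, serving the lead's assembly stub `stub_lateAssembly` (Dafermos–Rodnianski's red-shift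
boundedness argument on the lab foliation). On the lab slice `{x⁰ = t}`, `t ≥ 0`, of the strictly
receding configuration (thresholds `|aᵢ| ≤ Mᵢ/2`, lab speeds `≤ 1/2`, separations `≥ 40(Mᵢ + Mⱼ)`):

* `collar_subset_exterior`, `shell_subset_far` — a point of the collar `{r₊ᵢ < rᵢ ≤ r₊ᵢ + η Mᵢ}`
  (`η ≤ 1`) of hole `i` is exterior to every hole, and a point of the shell
  `{r₊ᵢ + η Mᵢ/2 ≤ rᵢ ≤ r₊ᵢ + η Mᵢ}` lies in the far set `{∀ j, r₊ⱼ + (η/2) Mⱼ ≤ rⱼ}` (zone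
  disjointness `stub_zoneDisjoint`: the other holes are at `rⱼ > 17 Mⱼ`);
* `exterior_subset_far_union_collars` — the exterior is covered by the far set and the half-collars
  `{r₊ᵢ < rᵢ ≤ r₊ᵢ + η Mᵢ/2}`;
* `lintegral_indicator_comp_le_setLIntegral`, `setLIntegral_le_lintegral_indicator_comp`,
  `lintegral_indicator_comp_le_add` — transferring pointwise comparisons of densities
  (`Σ(∂Φᵢ)²(qᵢ x) ≶ κ Σ(∂ψ)²(x)`) to the lab-slice integrals.

O'Neill 1983, Ch. 9; measure-theory folklore. [folklore]
-/

noncomputable section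

-- the doubled `FinalStateConjecture.FinalStateConjecture` path component trips dupNamespace
set_option linter.dupNamespace false

open scoped ENNReal BigOperators InnerProductSpace
open Set MeasureTheory Literature.Geometry.Lorentzian

namespace Summit.FinalStateConjecture.FinalStateConjecture.Cruxes.AdiabaticMultiKerrILED.Sketch

/-- `r₊ ≤ 2M` for `M ≥ 0` (`r₊ = M + √(M² − a²)`). [folklore] -/
private theorem lc_rPlus_le_two_mul {M : ℝ} (hM : 0 ≤ M) (a : ℝ) : Kerr.rPlus M a ≤ 2 * M := by
  unfold Kerr.rPlus
  have : Real.sqrt (M ^ 2 - a ^ 2) ≤ M := by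
    calc Real.sqrt (M ^ 2 - a ^ 2) ≤ Real.sqrt (M ^ 2) :=
          Real.sqrt_le_sqrt (sub_le_self _ (sq_nonneg a))
      _ = M := Real.sqrt_sq hM
  linarith

section Geometry

variable {N : ℕ} {M a : Fin N → ℝ} {Λ : Fin N → lorentzGroup} {p : Fin N → E3} {u : Fin N → E4}
  {q : Fin N → E4 → E4}

/-- **The other holes are far from a collar point**: at a lab point `x` with `x⁰ ≥ 0` and
`rᵢ(qᵢ x) ≤ 3Mᵢ`, every other hole has `rⱼ(qⱼ x) > 17 Mⱼ ≥ r₊ⱼ + Mⱼ` (zone disjointness).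
[folklore] -/
theorem radius_other_gt_of_radius_le_three_mul
    (hu : ∀ i, u i = (Λ i : E4 ≃L[ℝ] E4) (E4.basisVector 0))
    (hq : ∀ i x, q i x = poincareInv (Λ i) (E4.ofTimeSpace 0 (p i)) x)
    (hM : ∀ i, 0 < M i) (ha : ∀ i, |a i| ≤ 2⁻¹ * M i)
    (hv : ∀ i, 0 < u i 0 ∧ ‖E4.spatial (u i)‖ ≤ 2⁻¹ * u i 0)
    (hsep : ∀ i j, i ≠ j → 40 * (M i + M j) ≤ dist (p i) (p j) ∧
      0 < ⟪p i - p j, (u i 0)⁻¹ • E4.spatial (u i) - (u j 0)⁻¹ • E4.spatial (u j)⟫_ℝ)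
    {x : E4} (hx : 0 ≤ x 0) {i : Fin N} (hri : Kerr.radius (a i) (q i x) ≤ 3 * M i) :
    ∀ j, j ≠ i → Kerr.rPlus (M j) (a j) + M j < Kerr.radius (a j) (q j x) := by
  intro j hji
  have h17 : Kerr.radius (a i) (q i x) ≤ 17 * M i := by have := hM i; linarith
  have h := stub_zoneDisjoint M a Λ p u q hu hq hM ha hv hsep x hx i j (Ne.symm hji) h17
  have := lc_rPlus_le_two_mul (hM j).le (a j)
  have := hM j
  linarith

/-- **A collar point is exterior to every hole**: on the lab slice `{x⁰ = t}`, `t ≥ 0`, a point with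
`r₊ᵢ < rᵢ ≤ r₊ᵢ + η Mᵢ` (`η ≤ 1`) has `r₊ⱼ < rⱼ` for all `j`. [folklore] -/
theorem collar_subset_exterior
    (hu : ∀ i, u i = (Λ i : E4 ≃L[ℝ] E4) (E4.basisVector 0))
    (hq : ∀ i x, q i x = poincareInv (Λ i) (E4.ofTimeSpace 0 (p i)) x)
    (hM : ∀ i, 0 < M i) (ha : ∀ i, |a i| ≤ 2⁻¹ * M i)
    (hv : ∀ i, 0 < u i 0 ∧ ‖E4.spatial (u i)‖ ≤ 2⁻¹ * u i 0)
    (hsep : ∀ i j, i ≠ j → 40 * (M i + M j) ≤ dist (p i) (p j) ∧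
      0 < ⟪p i - p j, (u i 0)⁻¹ • E4.spatial (u i) - (u j 0)⁻¹ • E4.spatial (u j)⟫_ℝ)
    {η : ℝ} (hη1 : η ≤ 1) {t : ℝ} (ht : 0 ≤ t) (i : Fin N) {y : E3}
    (hy : Kerr.rPlus (M i) (a i) < Kerr.radius (a i) (q i (E4.ofTimeSpace t y)) ∧
      Kerr.radius (a i) (q i (E4.ofTimeSpace t y)) ≤ Kerr.rPlus (M i) (a i) + η * M i) :
    ∀ j, Kerr.rPlus (M j) (a j) < Kerr.radius (a j) (q j (E4.ofTimeSpace t y)) := by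
  intro j
  by_cases hji : j = i
  · subst hji; exact hy.1
  · have h3 : Kerr.radius (a i) (q i (E4.ofTimeSpace t y)) ≤ 3 * M i := by
      have := lc_rPlus_le_two_mul (hM i).le (a i)
      have := hM i
      nlinarith [hy.2]
    have h := radius_other_gt_of_radius_le_three_mul hu hq hM ha hv hsep (x := E4.ofTimeSpace t y)
      (by simpa using ht) h3 j hji
    have := hM j
    linarith

/-- **A shell point lies in the far set**: on the lab slice `{x⁰ = t}`, `t ≥ 0`, a point with
`r₊ᵢ + η Mᵢ/2 ≤ rᵢ ≤ r₊ᵢ + η Mᵢ` (`η ≤ 1`) has `r₊ⱼ + (η/2) Mⱼ ≤ rⱼ` for all `j`. [folklore] -/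
theorem shell_subset_far
    (hu : ∀ i, u i = (Λ i : E4 ≃L[ℝ] E4) (E4.basisVector 0))
    (hq : ∀ i x, q i x = poincareInv (Λ i) (E4.ofTimeSpace 0 (p i)) x)
    (hM : ∀ i, 0 < M i) (ha : ∀ i, |a i| ≤ 2⁻¹ * M i)
    (hv : ∀ i, 0 < u i 0 ∧ ‖E4.spatial (u i)‖ ≤ 2⁻¹ * u i 0)
    (hsep : ∀ i j, i ≠ j → 40 * (M i + M j) ≤ dist (p i) (p j) ∧
      0 < ⟪p i - p j, (u i 0)⁻¹ • E4.spatial (u i) - (u j 0)⁻¹ • E4.spatial (u j)⟫_ℝ)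
    {η : ℝ} (hη1 : η ≤ 1) {t : ℝ} (ht : 0 ≤ t) (i : Fin N) {y : E3}
    (hy : Kerr.rPlus (M i) (a i) + η * M i / 2 ≤ Kerr.radius (a i) (q i (E4.ofTimeSpace t y)) ∧
      Kerr.radius (a i) (q i (E4.ofTimeSpace t y)) ≤ Kerr.rPlus (M i) (a i) + η * M i) :
    ∀ j, Kerr.rPlus (M j) (a j) + η / 2 * M j ≤ Kerr.radius (a j) (q j (E4.ofTimeSpace t y)) := by
  intro j
  by_cases hji : j = i
  · subst hji; linarith [hy.1]
  · have h3 : Kerr.radius (a i) (q i (E4.ofTimeSpace t y)) ≤ 3 * M i := by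
      have := lc_rPlus_le_two_mul (hM i).le (a i)
      have := hM i
      nlinarith [hy.2]
    have h := radius_other_gt_of_radius_le_three_mul hu hq hM ha hv hsep (x := E4.ofTimeSpace t y)
      (by simpa using ht) h3 j hji
    have := hM j
    nlinarith

/-- **The exterior is covered by the far set and the half-collars**: if `r₊ᵢ < rᵢ` for all `i`, then
either `r₊ᵢ + (η/2) Mᵢ ≤ rᵢ` for all `i`, or some `i` has `r₊ᵢ < rᵢ ≤ r₊ᵢ + η Mᵢ/2` (pure logic).
[folklore] -/
theorem exterior_subset_far_union_collars (η t : ℝ) :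
    {y : E3 | ∀ i, Kerr.rPlus (M i) (a i) < Kerr.radius (a i) (q i (E4.ofTimeSpace t y))} ⊆
      {y : E3 | ∀ i, Kerr.rPlus (M i) (a i) + η / 2 * M i ≤
          Kerr.radius (a i) (q i (E4.ofTimeSpace t y))} ∪
        ⋃ i, {y : E3 | Kerr.rPlus (M i) (a i) < Kerr.radius (a i) (q i (E4.ofTimeSpace t y)) ∧
          Kerr.radius (a i) (q i (E4.ofTimeSpace t y)) ≤ Kerr.rPlus (M i) (a i) + η * M i / 2} := by
  intro y hy
  by_cases hfar : ∀ i, Kerr.rPlus (M i) (a i) + η / 2 * M i ≤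
      Kerr.radius (a i) (q i (E4.ofTimeSpace t y))
  · exact Or.inl hfar
  · push Not at hfar
    obtain ⟨i, hi⟩ := hfar
    refine Or.inr (Set.mem_iUnion.2 ⟨i, hy i, ?_⟩)
    linarith

end Geometry

/-! ### Pointwise comparisons of densities, integrated over a lab slice -/

/-- **From a pointwise bound on a rest-frame collar to the lab integral over a set**: if every `y`
with `r y ∈ S` lies in `T` and satisfies `f(r y) ≤ k g(y)`, then `∫ (1_S f)(r y) dy ≤ k ∫_T g`
(`T` measurable, `g` measurable). [folklore] -/
theorem lintegral_indicator_comp_le_setLIntegral {S : Set E4} {T : Set E3} (hT : MeasurableSet T)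
    {f : E4 → ℝ≥0∞} {g : E3 → ℝ≥0∞} (hg : Measurable g) {k : ℝ≥0∞} {r : E3 → E4}
    (h : ∀ y, r y ∈ S → y ∈ T ∧ f (r y) ≤ k * g y) :
    ∫⁻ y, S.indicator f (r y) ≤ k * ∫⁻ y in T, g y := by
  rw [← lintegral_indicator hT, ← lintegral_const_mul _ (hg.indicator hT)]
  refine lintegral_mono fun y ↦ ?_
  by_cases hy : r y ∈ S
  · rw [Set.indicator_of_mem hy, Set.indicator_of_mem (h y hy).1]
    exact (h y hy).2
  · rw [Set.indicator_of_notMem hy]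
    exact zero_le

/-- **From a pointwise bound on a lab set to the rest-frame collar integral**: if every `y ∈ T` has
`r y ∈ S` and `g(y) ≤ k f(r y)`, then `∫_T g ≤ k ∫ (1_S f)(r y) dy` (`T` measurable, `k ≠ ∞`).
[folklore] -/
theorem setLIntegral_le_lintegral_indicator_comp {S : Set E4} {T : Set E3} (hT : MeasurableSet T)
    {f : E4 → ℝ≥0∞} {g : E3 → ℝ≥0∞} {k : ℝ≥0∞} (hk : k ≠ ⊤) {r : E3 → E4}
    (h : ∀ y ∈ T, r y ∈ S ∧ g y ≤ k * f (r y)) :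
    ∫⁻ y in T, g y ≤ k * ∫⁻ y, S.indicator f (r y) := by
  rw [← lintegral_indicator hT, ← lintegral_const_mul' _ _ hk]
  refine lintegral_mono fun y ↦ ?_
  by_cases hy : y ∈ T
  · rw [Set.indicator_of_mem hy, Set.indicator_of_mem (h y hy).1]
    exact (h y hy).2
  · rw [Set.indicator_of_notMem hy]
    exact zero_le

/-- **Splitting a collar**: if `S₂ ⊆ S₁ ∪ S₃` then `∫ (1_{S₂} f)(r y) dy ≤ ∫ (1_{S₁} f)(r y) dy + ∫ (1_{S₃} f)(r y) dy`
(for `y ↦ (1_{S₁} f)(r y)` measurable). [folklore] -/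
theorem lintegral_indicator_comp_le_add {S₁ S₂ S₃ : Set E4} (hS : S₂ ⊆ S₁ ∪ S₃) (f : E4 → ℝ≥0∞)
    {r : E3 → E4} (h₁ : Measurable fun y ↦ S₁.indicator f (r y)) :
    ∫⁻ y, S₂.indicator f (r y) ≤ (∫⁻ y, S₁.indicator f (r y)) + ∫⁻ y, S₃.indicator f (r y) := by
  rw [← lintegral_add_left h₁]
  refine lintegral_mono fun y ↦ ?_
  by_cases h2 : r y ∈ S₂
  · rcases hS h2 with h1 | h3
    · rw [Set.indicator_of_mem h2, Set.indicator_of_mem h1]; exact le_self_add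
    · rw [Set.indicator_of_mem h2, Set.indicator_of_mem h3]; exact le_add_self
  · rw [Set.indicator_of_notMem h2]; exact zero_le

/-! ### Measurability of the collar densities -/

/-- The rest-frame collar sets `{r₁ < r ≤ r₂}`, `{r₁ ≤ r ≤ r₂}` are measurable (`r` is continuous).
[folklore] -/
theorem measurableSet_radius_collar (a r₁ r₂ : ℝ) :
    MeasurableSet {z : E4 | r₁ < Kerr.radius a z ∧ Kerr.radius a z ≤ r₂} ∧
      MeasurableSet {z : E4 | r₁ ≤ Kerr.radius a z ∧ Kerr.radius a z ≤ r₂} := by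
  have hc : Measurable (Kerr.radius a) := (Kerr.continuous_radius a).measurable
  exact ⟨(measurableSet_lt measurable_const hc).inter (measurableSet_le hc measurable_const),
    (measurableSet_le measurable_const hc).inter (measurableSet_le hc measurable_const)⟩

/-- The coordinate energy density `z ↦ Σ_μ (∂_μΦ)²(z)` (as an extended real) of a `C¹` function is
measurable. [folklore] -/
theorem measurable_energyDensity {Φ : E4 → ℝ} (hΦ : ContDiff ℝ 1 Φ) :
    Measurable fun z : E4 ↦ ENNReal.ofReal (∑ μ, fderiv ℝ Φ z (E4.basisVector μ) ^ 2) := by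
  refine ENNReal.measurable_ofReal.comp (continuous_finsetSum _ fun μ _ ↦ ?_).measurable
  exact ((hΦ.continuous_fderiv one_ne_zero).clm_apply continuous_const).pow 2

/-- Lab-slice sets cut out by continuous conditions on the rest-frame radii are measurable: for a
continuous family `ρ = (rᵢ ∘ qᵢ)` and any index set of strict/weak affine constraints — here the
three shapes used by the assembly. [folklore] -/
theorem measurableSet_slice_sets {N : ℕ} (ρ : Fin N → E4 → ℝ) (hρ : ∀ i, Continuous (ρ i))
    (b c : Fin N → ℝ) (t : ℝ) :
    MeasurableSet {y : E3 | ∀ i, b i < ρ i (E4.ofTimeSpace t y)} ∧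
      MeasurableSet {y : E3 | ∀ i, b i ≤ ρ i (E4.ofTimeSpace t y)} ∧
      ∀ i, MeasurableSet {y : E3 | b i < ρ i (E4.ofTimeSpace t y) ∧
        ρ i (E4.ofTimeSpace t y) ≤ c i} := by
  have hm : ∀ i, Measurable fun y : E3 ↦ ρ i (E4.ofTimeSpace t y) := fun i ↦
    ((hρ i).comp (E4.continuous_ofTimeSpace t)).measurable
  refine ⟨?_, ?_, fun i ↦ ?_⟩
  · simpa only [Set.setOf_forall] using
      MeasurableSet.iInter fun i ↦ measurableSet_lt measurable_const (hm i)
  · simpa only [Set.setOf_forall] using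
      MeasurableSet.iInter fun i ↦ measurableSet_le measurable_const (hm i)
  · exact (measurableSet_lt measurable_const (hm i)).inter (measurableSet_le (hm i) measurable_const)

end Summit.FinalStateConjecture.FinalStateConjecture.Cruxes.AdiabaticMultiKerrILED.Sketch

end
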